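import Summits.KontsevichZagierPeriods.Zeta5Search.Certificates.TwoTaleTelescopeFR

/-!
# (bmiss)@Ω — cert-2's certificate atoms of direction `f`, evaluated (cell `pub-zeta5`, cert-1 gen 4)

HONEST FRAMING: systematic search; recurrence certificates; no irrationality claim unless certified. Pure algebra over `ℚ`.

Values of the opaque atoms of `Certificates.TwoTaleTelescope.telescope_f_L` (variable `t`) and `telescope_f_R` (at `t = u/2`,
`u` the lattice variable): the Γ-ratio linear-form products `lprod numF•k/denF•k/tnF•/tdF•/cnumF•/cnumSF•/cdenF•/cdenSF•`, and the
certificate numerators — the cubic `x_L(t) = Σ_{j<4} x_j t^j` of side `L` as an explicit polynomial `xPolyFL` in `ℚ[X]`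
(`eval_xPolyFL : (xPolyFL …).eval (t+s) = polyTN xFL s … t`) and the `t`-free `x_R` (`xFRv`, `polyTN_xFR`). Mirror of `CertAtomsE`.
-/

noncomputable section

open Polynomial
open Summit.KontsevichZagierPeriods.Zeta5Search.Certificates.TwoTaleTelescope

namespace Summit.KontsevichZagierPeriods.Zeta5Search.TwoTaleOmega

/-- Value of cert-2's atom `lprod numFL1`. -/
theorem numFL1_eval (a b e f g t : ℚ) : lprod numFL1 a b e f g t = (f + t) * (a - f + t) := by
  simp only [lprod_cons, lprod_nil, lval, numFL1, List.getD_cons_zero, List.getD_cons_succ]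
  push_cast; ring

/-- Value of cert-2's atom `lprod numFL2`. -/
theorem numFL2_eval (a b e f g t : ℚ) : lprod numFL2 a b e f g t = (f + t) * (f + t + 1) * (a - f + t) * (a - f + t - 1) := by
  simp only [lprod_cons, lprod_nil, lval, numFL2, List.getD_cons_zero, List.getD_cons_succ]
  push_cast; ring

/-- Value of cert-2's atom `lprod numFL3`. -/
theorem numFL3_eval (a b e f g t : ℚ) : lprod numFL3 a b e f g t = (f + t) * (f + t + 1) * (f + t + 2) * (a - f + t) * (a - f + t - 1) * (a - f + t - 2) := by
  simp only [lprod_cons, lprod_nil, lval, numFL3, List.getD_cons_zero, List.getD_cons_succ]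
  push_cast; ring

/-- Value of cert-2's atom `lprod tnFL`. -/
theorem tnFL_eval (a b e f g t : ℚ) : lprod tnFL a b e f g t = (a + t) * (b + t) * (e + t) * (f + t) := by
  simp only [lprod_cons, lprod_nil, lval, tnFL, List.getD_cons_zero, List.getD_cons_succ]
  push_cast; ring

/-- Value of cert-2's atom `lprod tdFL`. -/
theorem tdFL_eval (a b e f g t : ℚ) : lprod tdFL a b e f g t = (t + 1) * (a - e + t + 1) * (a - f + t + 1) * (g + t) := by
  simp only [lprod_cons, lprod_nil, lval, tdFL, List.getD_cons_zero, List.getD_cons_succ]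
  push_cast; ring

/-- Value of cert-2's atom `lprod cnumFL`. -/
theorem cnumFL_eval (a b e f g t : ℚ) : lprod cnumFL a b e f g t = (t) * (a - e + t) * (a - f + t) * (g + t - 1) := by
  simp only [lprod_cons, lprod_nil, lval, cnumFL, List.getD_cons_zero, List.getD_cons_succ]
  push_cast; ring

/-- Value of cert-2's atom `lprod cnumSFL`. -/
theorem cnumSFL_eval (a b e f g t : ℚ) : lprod cnumSFL a b e f g t = (t + 1) * (a - e + t + 1) * (a - f + t + 1) * (g + t) := by
  simp only [lprod_cons, lprod_nil, lval, cnumSFL, List.getD_cons_zero, List.getD_cons_succ]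
  push_cast; ring

/-- Value of cert-2's atom `lprod numFR1` at `t = u/2`. -/
theorem numFR1_eval (a b e f g u : ℚ) : lprod numFR1 a b e f g (u / 2) = (-a + e + f) * (f) * (f + u / 2) := by
  simp only [lprod_cons, lprod_nil, lval, numFR1, List.getD_cons_zero, List.getD_cons_succ]
  push_cast; ring

/-- Value of cert-2's atom `lprod numFR2` at `t = u/2`. -/
theorem numFR2_eval (a b e f g u : ℚ) : lprod numFR2 a b e f g (u / 2) = (-a + e + f) * (-a + e + f + 1) * (f) * (f + 1) * (f + u / 2) * (f + u / 2 + 1) := by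
  simp only [lprod_cons, lprod_nil, lval, numFR2, List.getD_cons_zero, List.getD_cons_succ]
  push_cast; ring

/-- Value of cert-2's atom `lprod numFR3` at `t = u/2`. -/
theorem numFR3_eval (a b e f g u : ℚ) : lprod numFR3 a b e f g (u / 2) = (-a + e + f) * (-a + e + f + 1) * (-a + e + f + 2) * (f) * (f + 1) * (f + 2) * (f + u / 2) * (f + u / 2 + 1) * (f + u / 2 + 2) := by
  simp only [lprod_cons, lprod_nil, lval, numFR3, List.getD_cons_zero, List.getD_cons_succ]
  push_cast; ring

/-- Value of cert-2's atom `lprod denFR1` at `t = u/2`. -/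
theorem denFR1_eval (a b e f g u : ℚ) : lprod denFR1 a b e f g (u / 2) = (e + f + u / 2) := by
  simp only [lprod_cons, lprod_nil, lval, denFR1, List.getD_cons_zero, List.getD_cons_succ]
  push_cast; ring

/-- Value of cert-2's atom `lprod denFR2` at `t = u/2`. -/
theorem denFR2_eval (a b e f g u : ℚ) : lprod denFR2 a b e f g (u / 2) = (e + f + u / 2) * (e + f + u / 2 + 1) := by
  simp only [lprod_cons, lprod_nil, lval, denFR2, List.getD_cons_zero, List.getD_cons_succ]
  push_cast; ring

/-- Value of cert-2's atom `lprod denFR3` at `t = u/2`. -/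
theorem denFR3_eval (a b e f g u : ℚ) : lprod denFR3 a b e f g (u / 2) = (e + f + u / 2) * (e + f + u / 2 + 1) * (e + f + u / 2 + 2) := by
  simp only [lprod_cons, lprod_nil, lval, denFR3, List.getD_cons_zero, List.getD_cons_succ]
  push_cast; ring

/-- Value of cert-2's atom `lprod tnFR` at `t = u/2`. -/
theorem tnFR_eval (a b e f g u : ℚ) : lprod tnFR a b e f g (u / 2) = (a - b + g + u) * (a - b + g + u + 1) * (a + u / 2) * (e + u / 2) * (f + u / 2) := by
  simp only [lprod_cons, lprod_nil, lval, tnFR, List.getD_cons_zero, List.getD_cons_succ]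
  push_cast; ring

/-- Value of cert-2's atom `lprod tdFR` at `t = u/2`. -/
theorem tdFR_eval (a b e f g u : ℚ) : lprod tdFR a b e f g (u / 2) = (a + u + 1) * (a + u + 2) * (a - b + u / 2 + 1) * (e + f + u / 2) * (g + u / 2) := by
  simp only [lprod_cons, lprod_nil, lval, tdFR, List.getD_cons_zero, List.getD_cons_succ]
  push_cast; ring

/-- Value of cert-2's atom `lprod cnumFR` at `t = u/2`. -/
theorem cnumFR_eval (a b e f g u : ℚ) : lprod cnumFR a b e f g (u / 2) = (a + u - 1) * (a + u) * (a - b + u / 2) * (g + u / 2 - 1) * (e + f + u / 2 + 2) := by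
  simp only [lprod_cons, lprod_nil, lval, cnumFR, List.getD_cons_zero, List.getD_cons_succ]
  push_cast; ring

/-- Value of cert-2's atom `lprod cnumSFR` at `t = u/2`. -/
theorem cnumSFR_eval (a b e f g u : ℚ) : lprod cnumSFR a b e f g (u / 2) = (a + u + 1) * (a + u + 2) * (a - b + u / 2 + 1) * (g + u / 2) * (e + f + u / 2 + 3) := by
  simp only [lprod_cons, lprod_nil, lval, cnumSFR, List.getD_cons_zero, List.getD_cons_succ]
  push_cast; ring

/-- Value of cert-2's atom `lprod cdenFR` at `t = u/2`. -/
theorem cdenFR_eval (a b e f g u : ℚ) : lprod cdenFR a b e f g (u / 2) = (e + f + u / 2) * (e + f + u / 2 + 1) * (e + f + u / 2 + 2) := by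
  simp only [lprod_cons, lprod_nil, lval, cdenFR, List.getD_cons_zero, List.getD_cons_succ]
  push_cast; ring

/-- Value of cert-2's atom `lprod cdenSFR` at `t = u/2`. -/
theorem cdenSFR_eval (a b e f g u : ℚ) : lprod cdenSFR a b e f g (u / 2) = (e + f + u / 2 + 1) * (e + f + u / 2 + 2) * (e + f + u / 2 + 3) := by
  simp only [lprod_cons, lprod_nil, lval, cdenSFR, List.getD_cons_zero, List.getD_cons_succ]
  push_cast; ring

/-- The `j`-th coefficient `x_j(a,b,e,f,g)` of the side-`L` certificate numerator of direction `f`. -/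
def xFLc (j : ℕ) (a b e f g : ℚ) : ℚ := spvalC (xFL.getD j []) a b e f g

/-- The side-`L` certificate numerator of direction `f` as a polynomial in `t`: `x_L = x₀ + x₁X + x₂X² + x₃X³`. -/
def xPolyFL (a b e f g : ℚ) : ℚ[X] :=
  C (xFLc 0 a b e f g) + C (xFLc 1 a b e f g) * X + C (xFLc 2 a b e f g) * X ^ 2 + C (xFLc 3 a b e f g) * X ^ 3

/-- `x_L` evaluated at `t + s` is cert-2's atom `polyTN xFL s`. -/
theorem eval_xPolyFL (s : ℤ) (a b e f g t : ℚ) : (xPolyFL a b e f g).eval (t + s) = polyTN xFL s a b e f g t := by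
  have hl : xFL.length = 4 := rfl
  simp only [polyTN, hl, xPolyFL, xFLc, eval_add, eval_mul, eval_C, eval_X, eval_pow]
  simp [List.range_succ]
  ring

/-- `deg x_L ≤ 3`. -/
theorem natDegree_xPolyFL_le (a b e f g : ℚ) : (xPolyFL a b e f g).natDegree ≤ 3 := by
  unfold xPolyFL
  refine (natDegree_add_le _ _).trans (max_le ((natDegree_add_le _ _).trans (max_le ((natDegree_add_le _ _).trans
    (max_le ?_ ?_)) ?_)) ?_)
  · exact (natDegree_C _).le.trans (by norm_num)
  · exact (natDegree_C_mul_le _ _).trans (natDegree_X_le.trans (by norm_num))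
  · exact (natDegree_C_mul_le _ _).trans ((natDegree_pow_le).trans (by simp))
  · exact (natDegree_C_mul_le _ _).trans ((natDegree_pow_le).trans (by simp))

/-- The (t-free) side-`R` certificate numerator `x_R(a,b,e,f,g)` of direction `f`. -/
def xFRv (a b e f g : ℚ) : ℚ := spvalC (xFR.getD 0 []) a b e f g

/-- cert-2's atom `polyTN xFR s` is the constant `x_R`. -/
theorem polyTN_xFR (s : ℤ) (a b e f g t : ℚ) : polyTN xFR s a b e f g t = xFRv a b e f g := by
  have hl : xFR.length = 1 := rfl
  simp [polyTN, hl, xFRv]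

end Summit.KontsevichZagierPeriods.Zeta5Search.TwoTaleOmega

end
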